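import Summits.QuantumFields.YangMills.Theorems.UnitScaleTiltProp7Lane2GradCommH1Member
import Literature.MathematicalPhysics.QuantumFieldTheory.Balaban1983to89.T4PlaqDisjointFamilies
import HarnessLib

/-!
# Route `UnitScaleTilt`, crux «MinimiserStabilityRegPr» (stmt-QuantumFields-19200), E′ ∕ (N06) LANE II «DIVERGENCE RECOVERY AT CURVED `W`» — brick (B6-LOC), FILE 1 of 2:
# THE PER-PATCH COMMUTATOR ROWS `h6` (GRADIENT) AND `h5` (LAPLACIAN) OF [I-9] IN `hPatch`'s OPERATOR LETTERS, LOCALISED TO THE TRANSITION SET OF ONE CUTOFF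

Cell `ym3-torus`, width seat `ym3-torus-px11` (gen 7); ★p1 g19 RECIPE-hPatch v2.1 (G) «remaining per-patch rows … h5 h6 h11 (px11 (R1)(R2)∕h11 per-c readings)», frozen
schema `hPatch` of ✓`Prop7DivRecoveryPatchesToRows.hRows_of_core_and_patches` (per-patch reals `Li Mi HMi`).  THEOREMS ONLY (0 `def`, 0 `sorry`); `--supports stmt-QuantumFields-19200`,
count-neutral.  YM₃ on T³ is a ladder rung (R3), not the Clay problem; nothing here claims (B7), (REC), `hN06`, a stub, the crux, d = 4 or the mass gap.

THE POINT.  ✓`Prop7Lane2CutoffPackage.exists_cutoffPackage` exports the cutoffs as LINEAR MAPS `Zs c`, `Zb c` through the (Z2) readings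
`toL2S⁻¹(Zs c φ) x = ζ c x • toL2S⁻¹φ x`, `toL2⁻¹(Zb c f) b = ζ c b.src • toL2⁻¹f b`, and the rows (R1)(R2) SUMMED over `c` with GLOBAL right sides.  The knit's budget
(✓`Prop7DivRecoveryAssemblyBudgetW4.patch_budget_v2`: `h5 : L ≤ Cζ(R⁻²N + R⁻⁴Φ)`, `h6 : M ≤ CM·R⁻²·Φt`, `h11 : HM ≤ CH(R⁻²Gφ + R⁻⁴Φ)`) needs them PER PATCH and LOCAL: the
zero-extended chart potential `φ_c` carries boundary-layer jumps in its GLOBAL `‖D_W φ_c‖²` (RECIPE v1, TRAP 1), while every commutator with `ζ_c` reads `φ_c`, `D_W φ_c` only on the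
TRANSITION SET of `ζ_c` (radius `L^s·ℓ + 2` about `c`, deep inside the patch).  This file reads the lineage's localised lattice rows ✓`Prop7Lane2CutoffCommutators.norm_sq_DL2_smul_sub_le (S)`
∕ `norm_sq_covLapSite_comm_le (S)` in the OPERATOR letters of `hPatch` — for ANY linear `Z`, `ZE` with the (Z2) readings of one real `ζ`, ANY `φ : SiteL2K`, ANY finsets `S ⊆ S'` with
«`ζ` constant on the 2-cell about every `x ∉ S`» and «`S'` ∋ `x, x ± e_μ, x + e_μ + e_ν` for `x ∈ S`» (steps `|∂ζ| ≤ a`, second differences `|∂²ζ| ≤ a₂`, `ℓ = L^{K−n}`):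
* §2 (h6-loc) `‖D_W(Z φ) − ZE(D_W φ)‖² ≤ 3a²ℓ²·Φ_S` — RECIPE TRAP 2's indicator built in;
* §3 (h5-loc) `‖Δ_W(Z φ) − Z(Δ_W φ)‖² ≤ 18a²ℓ²·G_{S'} + 27a₂²ℓ⁴·Φ_S` — LOCAL gradient energy only, so TRAP 1 never arises and no `ζ̃` is needed;
* §4 at the package's `a = (3∕2)(L^s·ℓ)⁻¹`, `a₂ = 6(L^s·ℓ)⁻²`: `(27∕4)·R⁻²·Φ_S` (the budget's `h6` with `CM = 27∕4`, `Φt = Φ_S` = px9 (a′)'s box mass via ✓∕⧗`sum_le_boxSum_of_chart`) and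
  `(81∕2)·R⁻²·G_{S'} + 972·R⁻⁴·Φ_S`, slot shape `972·(R⁻²G_{S'} + R⁻⁴Φ_S)` (`R = L^s`),
with `Φ_S := c₀·Σ_{x∈S}‖toL2S⁻¹φ x‖_F²`, `G_{S'} := c₀·Σ_{y∈S'}Σ_μ‖toL2⁻¹(D_W φ)⟨y,μ⟩‖_F²` (the knit bounds `G_{S'} ≤ Gφ_c ≤ N_c` by (B8-member) (D) + (h1) when `S'` lies in the chart).
§1 records the operators in function letters and the SUPPORTS of both commutators (for ✓`Prop7Lane2OverlapRows`' family rows).  FILE 2 (`…PatchCommutatorH1`): the `h11` row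
(`H u := c₀ℓ²·CURL_HS u + ‖D*_W u‖²`) and the localisation hypothesis discharged from the package's support row.
HONEST SCOPE.  Hilbert∕lattice bookkeeping over landed rows; nothing of `hPatch`∕(B7)∕(REC)∕hN06∕the crux is proved or claimed.

References: T. Bałaban, CMP 99 (1985) 389–434 [Balaban1985BackgroundPropagators] ((3.3) p.391, (3.11) p.392, (3.19) p.393, (3.23) p.394, (3.100) pp.413–414); CMP 102 (1985) 277–309
[Balaban1985Variational] ((5) p.278); CMP 96 (1984) 223–250 [Balaban1984PropagatorsII] (p.238).
-/

set_option autoImplicit false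

noncomputable section

open scoped BigOperators Matrix.Norms.L2Operator Matrix

namespace Summit.QuantumFields.YangMills.Theorems.Prop7Lane2PatchCommutatorRows

open Literature.MathematicalPhysics.QuantumFieldTheory.Balaban1983to89
open Literature.MathematicalPhysics.QuantumFieldTheory.Balaban1983to89.T3ContinuumYM3Torus
open Literature.MathematicalPhysics.QuantumFieldTheory.Balaban1983to89.T3PrintedRegularMinimiser (RegPr)
open T3SectALandauChart (covDerivFwdT bgUnits eta eta_pos)
open B10Eq27TorusAxialLog (unitsField toUField)
open B7Prop1Explicit (U1 mem_U1)
open B9Eq39Adjoint (R covD covDstar divB curl)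
open B9TorusCalculus (torusT torusT_apply torusT_symm_apply torusT_comm)
open B10StarCount (shift_unshift unshift_shift)
open B11Eq103H1Complex (SiteL2K BondL2K)
open Summit.QuantumFields.YangMills.Theorems.Prop7SectET3Transport (periodsT3)
open Summit.QuantumFields.YangMills.Theorems.Prop7SectET3HilbertLetters (W₂ toL2 toL2S DL2 DstarL2 covLapSite)
open Summit.QuantumFields.YangMills.Theorems.Prop7SecondOrderDict (covDerivFwdT_eq_smul_covD)
open Summit.QuantumFields.YangMills.Theorems.Prop7LandauDict (DL2_toL2S_eq_covDerivFwdT)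
open Summit.QuantumFields.YangMills.Theorems.Prop7DivSliceOfMemberDivSq (norm_sq_DstarL2_toL2_eq inv_eta_sq_eq)
open Summit.QuantumFields.YangMills.Theorems.Prop7LaplaceAFlatLetters (norm_sq_toL2 norm_sq_toL2S)
open Summit.QuantumFields.YangMills.Theorems.Prop7CovariantCoercivity (sum_norm_sq_R hyp_of_specialUnitary)
open Summit.QuantumFields.YangMills.Theorems.Prop7CovAgmonLetters (hs_smul)
open Summit.QuantumFields.YangMills.Theorems.Prop7Lane2CutoffCommutators (coe_bgUnits_mem_unitary DL2_smul_sub_smul_apply DL2_smul_sub_smul_eq_toL2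
  norm_sq_DL2_smul_sub_le covLapSite_comm_apply_eq_zero covLapSite_comm_eq_toL2S norm_sq_covLapSite_comm_le)
open Summit.QuantumFields.YangMills.Theorems.Prop7Lane2GradCommH1 (curl_gradComm_eq hs_curl_gradComm_point_le hs_divB_gradComm_sum_le sum_ite_lt_le_sum
  norm_transport_comm_le_of_regPr)
open Summit.QuantumFields.YangMills.Theorems.Prop7Lane2CyclicHats (dist_add_one_le dist_sub_one_le)
open Literature.MathematicalPhysics.QuantumFieldTheory.Balaban1983to89.T4PlaqDisjointFamilies (shift_injective)
open Finset

variable (F : T3Family) (n K : ℕ) (c₀ : ℝ) [Fact (0 < c₀)]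

/-! ## §1 The cutoff operators in function letters; supports of the two commutators -/

section Letters

variable (Z : SiteL2K ℂ 3 (periodsT3 F K) c₀ W₂ →ₗ[ℂ] SiteL2K ℂ 3 (periodsT3 F K) c₀ W₂)
  (ZE : BondL2K ℂ 3 (periodsT3 F K) c₀ W₂ →ₗ[ℂ] BondL2K ℂ 3 (periodsT3 F K) c₀ W₂) (ζ : Site (F.P K) 0 → ℝ)

omit [Fact (0 < c₀)] in
/-- A site operator with the (Z2) reading IS multiplication by `ζ` on the functions: `Z φ = toL2S (ζ • toL2S⁻¹φ)`. [cite: Balaban1985BackgroundPropagators, (3.19) p.393] -/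
theorem siteCutoff_eq_toL2S (hZ : ∀ φ x, (toL2S F K c₀).symm (Z φ) x = ζ x • (toL2S F K c₀).symm φ x) (φ : SiteL2K ℂ 3 (periodsT3 F K) c₀ W₂) :
    Z φ = toL2S F K c₀ (fun x => ζ x • (toL2S F K c₀).symm φ x) := by
  apply (toL2S F K c₀).symm.injective
  rw [LinearEquiv.symm_apply_apply]
  funext x
  exact hZ φ x

omit [Fact (0 < c₀)] in
/-- A bond operator with the (Z2) reading IS multiplication by `ζ(b₋)` on the bond functions: `ZE f = toL2 (ζ(·₋) • toL2⁻¹f)`. [cite: Balaban1985BackgroundPropagators, (3.19) p.393] -/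
theorem bondCutoff_eq_toL2 (hZE : ∀ f b, (toL2 F K c₀).symm (ZE f) b = ζ b.src • (toL2 F K c₀).symm f b) (f : BondL2K ℂ 3 (periodsT3 F K) c₀ W₂) :
    ZE f = toL2 F K c₀ (fun b => ζ b.src • (toL2 F K c₀).symm f b) := by
  apply (toL2 F K c₀).symm.injective
  rw [LinearEquiv.symm_apply_apply]
  funext b
  exact hZE f b

/-- ★ **THE GRADIENT COMMUTATOR IN FUNCTION LETTERS**: `D_W(Z φ) − ZE(D_W φ) = D_W(toL2S(ζ•λ)) − toL2(ζ(·₋)•toL2⁻¹(D_W(toL2S λ)))`, `λ := toL2S⁻¹φ` — the `u` of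
✓`Prop7Lane2GradCommH1.H1_energy_gradComm_le`. [cite: Balaban1985BackgroundPropagators, (3.3) p.391, (3.100) pp.413–414] -/
theorem gradComm_eq_fun (hZ : ∀ φ x, (toL2S F K c₀).symm (Z φ) x = ζ x • (toL2S F K c₀).symm φ x)
    (hZE : ∀ f b, (toL2 F K c₀).symm (ZE f) b = ζ b.src • (toL2 F K c₀).symm f b) (W : GaugeField (F.P K) 0 (Matrix.specialUnitaryGroup (Fin 2) ℂ)) (φ : SiteL2K ℂ 3 (periodsT3 F K) c₀ W₂) :
    DL2 F n K c₀ W (Z φ) - ZE (DL2 F n K c₀ W φ)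
      = DL2 F n K c₀ W (toL2S F K c₀ (fun x => ζ x • (toL2S F K c₀).symm φ x))
        - toL2 F K c₀ (fun b => ζ b.src • (toL2 F K c₀).symm (DL2 F n K c₀ W (toL2S F K c₀ ((toL2S F K c₀).symm φ))) b) := by
  rw [siteCutoff_eq_toL2S F K c₀ Z ζ hZ φ, bondCutoff_eq_toL2 F K c₀ ZE ζ hZE, LinearEquiv.apply_symm_apply]

/-- ★ **THE LAPLACIAN COMMUTATOR IN FUNCTION LETTERS**: `Δ_W(Z φ) − Z(Δ_W φ) = Δ_W(toL2S(ζ•λ)) − toL2S(ζ • toL2S⁻¹(Δ_W(toL2S λ)))`, `λ := toL2S⁻¹φ`.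
[cite: Balaban1985BackgroundPropagators, (3.23) p.394, (3.100) pp.413–414] -/
theorem lapComm_eq_fun (hZ : ∀ φ x, (toL2S F K c₀).symm (Z φ) x = ζ x • (toL2S F K c₀).symm φ x) (W : GaugeField (F.P K) 0 (Matrix.specialUnitaryGroup (Fin 2) ℂ)) (φ : SiteL2K ℂ 3 (periodsT3 F K) c₀ W₂) :
    covLapSite F n K c₀ W (Z φ) - Z (covLapSite F n K c₀ W φ)
      = covLapSite F n K c₀ W (toL2S F K c₀ (fun x => ζ x • (toL2S F K c₀).symm φ x))
        - toL2S F K c₀ (fun x => ζ x • (toL2S F K c₀).symm (covLapSite F n K c₀ W (toL2S F K c₀ ((toL2S F K c₀).symm φ))) x) := by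
  rw [siteCutoff_eq_toL2S F K c₀ Z ζ hZ φ, siteCutoff_eq_toL2S F K c₀ Z ζ hZ (covLapSite F n K c₀ W φ), LinearEquiv.apply_symm_apply]

/-- ★ **THE GRADIENT COMMUTATOR READ AT A BOND**: `toL2⁻¹(D_W(Z φ) − ZE(D_W φ))(b) = (ℓ(ζ(b₊) − ζ(b₋)))•Ad(W♭_b)λ(b₊)`, `ℓ = (eta F n K)⁻¹`.
[cite: Balaban1985BackgroundPropagators, (3.3) p.391] -/
theorem gradComm_apply (hZ : ∀ φ x, (toL2S F K c₀).symm (Z φ) x = ζ x • (toL2S F K c₀).symm φ x)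
    (hZE : ∀ f b, (toL2 F K c₀).symm (ZE f) b = ζ b.src • (toL2 F K c₀).symm f b) (W : GaugeField (F.P K) 0 (Matrix.specialUnitaryGroup (Fin 2) ℂ)) (φ : SiteL2K ℂ 3 (periodsT3 F K) c₀ W₂) (b : PBond (F.P K) 0) :
    (toL2 F K c₀).symm (DL2 F n K c₀ W (Z φ) - ZE (DL2 F n K c₀ W φ)) b
      = ((eta F n K)⁻¹ * (ζ b.tgt - ζ b.src)) • R (bgUnits F K W b) ((toL2S F K c₀).symm φ b.tgt) := by
  rw [gradComm_eq_fun F n K c₀ Z ZE ζ hZ hZE W φ, DL2_smul_sub_smul_eq_toL2, LinearEquiv.symm_apply_apply]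

/-- **SUPPORT OF THE GRADIENT COMMUTATOR**: it vanishes on every bond along which `ζ` does not change (so its 1-collared support lies in the one-step
neighbourhood of the transition set — the `hsupp` of ✓`Prop7Lane2OverlapRows.localEnergy_sum_le_of_overlap`). [cite: Balaban1985BackgroundPropagators, (3.100) pp.413–414] -/
theorem gradComm_apply_eq_zero (hZ : ∀ φ x, (toL2S F K c₀).symm (Z φ) x = ζ x • (toL2S F K c₀).symm φ x)
    (hZE : ∀ f b, (toL2 F K c₀).symm (ZE f) b = ζ b.src • (toL2 F K c₀).symm f b) (W : GaugeField (F.P K) 0 (Matrix.specialUnitaryGroup (Fin 2) ℂ)) (φ : SiteL2K ℂ 3 (periodsT3 F K) c₀ W₂) (b : PBond (F.P K) 0)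
    (hb : ζ b.tgt = ζ b.src) :
    (toL2 F K c₀).symm (DL2 F n K c₀ W (Z φ) - ZE (DL2 F n K c₀ W φ)) b = 0 := by
  rw [gradComm_apply F n K c₀ Z ZE ζ hZ hZE, hb, sub_self, mul_zero, zero_smul]

/-- **SUPPORT OF THE LAPLACIAN COMMUTATOR**: it vanishes at every site where `ζ` is locally constant (all six first differences zero).
[cite: Balaban1985BackgroundPropagators, (3.100) pp.413–414; Balaban1984PropagatorsII, p.238] -/
theorem lapComm_apply_eq_zero (hZ : ∀ φ x, (toL2S F K c₀).symm (Z φ) x = ζ x • (toL2S F K c₀).symm φ x) (W : GaugeField (F.P K) 0 (Matrix.specialUnitaryGroup (Fin 2) ℂ)) (φ : SiteL2K ℂ 3 (periodsT3 F K) c₀ W₂) (x : Site (F.P K) 0)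
    (hx : ∀ μ : Fin 3, ζ (x.shift μ) = ζ x ∧ ζ (x.unshift μ) = ζ x) :
    (toL2S F K c₀).symm (covLapSite F n K c₀ W (Z φ) - Z (covLapSite F n K c₀ W φ)) x = 0 := by
  rw [lapComm_eq_fun F n K c₀ Z ζ hZ W φ, covLapSite_comm_eq_toL2S, LinearEquiv.symm_apply_apply]
  exact covLapSite_comm_apply_eq_zero F n K c₀ W ζ ((toL2S F K c₀).symm φ) x hx

end Letters

/-! ## §2 ★★ (h6-loc) — the gradient commutator, localised to the transition set -/

section GradRow

variable (W : GaugeField (F.P K) 0 (Matrix.specialUnitaryGroup (Fin 2) ℂ))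
  (Z : SiteL2K ℂ 3 (periodsT3 F K) c₀ W₂ →ₗ[ℂ] SiteL2K ℂ 3 (periodsT3 F K) c₀ W₂)
  (ZE : BondL2K ℂ 3 (periodsT3 F K) c₀ W₂ →ₗ[ℂ] BondL2K ℂ 3 (periodsT3 F K) c₀ W₂) (ζ : Site (F.P K) 0 → ℝ)

/-- ★★ **(h6-loc)**: if `|ζ(x+e_μ) − ζ(x)| ≤ a` and `ζ` is constant on the 2-cell about every site off `S` (in particular every bond along which `ζ` changes has its target in `S`),
then for EVERY `φ`: `‖D_W(Z φ) − ZE(D_W φ)‖² ≤ 3a²ℓ²·(c₀·Σ_{x∈S}‖toL2S⁻¹φ x‖_F²)` — RECIPE v1 TRAP 2's `𝟙_{A_c}`-restriction built in, no indicator on `φ`.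
[cite: Balaban1985BackgroundPropagators, (3.3) p.391, (3.100) pp.413–414; Balaban1984PropagatorsII, p.238] -/
theorem norm_sq_gradComm_le_local (hZ : ∀ φ x, (toL2S F K c₀).symm (Z φ) x = ζ x • (toL2S F K c₀).symm φ x)
    (hZE : ∀ f b, (toL2 F K c₀).symm (ZE f) b = ζ b.src • (toL2 F K c₀).symm f b) {a : ℝ} (S : Finset (Site (F.P K) 0))
    (hζ1 : ∀ (x : Site (F.P K) 0) (μ : Fin 3), |ζ (x.shift μ) - ζ x| ≤ a)
    (hζS : ∀ x : Site (F.P K) 0, x ∉ S → ∀ μ : Fin 3, ζ (x.shift μ) = ζ x ∧ ζ (x.unshift μ) = ζ x ∧ ∀ ν : Fin 3, ζ ((x.shift μ).shift ν) = ζ (x.shift μ))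
    (φ : SiteL2K ℂ 3 (periodsT3 F K) c₀ W₂) :
    ‖DL2 F n K c₀ W (Z φ) - ZE (DL2 F n K c₀ W φ)‖ ^ 2
      ≤ 3 * a ^ 2 * ((F.L : ℝ) ^ (K - n)) ^ 2 * (c₀ * ∑ x ∈ S, ∑ j : Fin 2, ∑ k : Fin 2, ‖((toL2S F K c₀).symm φ x) j k‖ ^ 2) := by
  have hS : ∀ (x : Site (F.P K) 0) (μ : Fin 3), ζ (x.shift μ) ≠ ζ x → x.shift μ ∈ S := by
    intro x μ h
    by_contra hx
    have := (hζS (x.shift μ) hx μ).2.1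
    rw [unshift_shift] at this
    exact h this.symm
  rw [gradComm_eq_fun F n K c₀ Z ZE ζ hZ hZE W φ, ← inv_eta_sq_eq F n K]
  have h := norm_sq_DL2_smul_sub_le F n K c₀ W ζ ((toL2S F K c₀).symm φ) S hζ1 hS
  rw [LinearEquiv.apply_symm_apply] at h ⊢
  linarith [h]

end GradRow

/-! ## §3 ★★ (h5-loc) — the Laplacian commutator, localised to the transition set -/

section Bookkeeping

/-- Re-indexing a sum along an injective map that sends `S` into `S'` (non-negative summands): `Σ_{x∈S} f(g x) ≤ Σ_{y∈S'} f y`. [folklore] -/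
theorem sum_comp_le_sum_of_mapsTo {α : Type*} [DecidableEq α] (S S' : Finset α) (g : α → α) (hg : Function.Injective g)
    (hS : ∀ x ∈ S, g x ∈ S') (f : α → ℝ) (hf : ∀ y, 0 ≤ f y) : ∑ x ∈ S, f (g x) ≤ ∑ y ∈ S', f y := by
  rw [← Finset.sum_image (f := f) fun x _ y _ h => hg h]
  refine Finset.sum_le_sum_of_subset_of_nonneg (fun y hy => ?_) fun y _ _ => hf y
  obtain ⟨x, hx, rfl⟩ := Finset.mem_image.mp hy
  exact hS x hx

/-- One lattice step back `x ↦ x − e_μ` is injective on the torus sites. [folklore] -/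
theorem unshift_injective {P : Params} {j : ℕ} (μ : Fin P.d) : Function.Injective fun x : Site P j => x.unshift μ := by
  intro x y h
  have := congrArg (fun z : Site P j => z.shift μ) h
  simpa only [shift_unshift] using this

/-- Counting direction pairs: `Σ_μΣ_ν (c₁(A_μ + A_ν) + c₂) = 2·#ι·c₁·Σ_μ A_μ + (#ι)²·c₂`. [folklore] -/
theorem sum_pair_count {ι : Type*} [Fintype ι] (A : ι → ℝ) (c₁ c₂ : ℝ) :
    ∑ μ, ∑ ν, (c₁ * (A μ + A ν) + c₂) = 2 * (Fintype.card ι : ℝ) * c₁ * ∑ μ, A μ + (Fintype.card ι : ℝ) ^ 2 * c₂ := by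
  simp only [mul_add, Finset.sum_add_distrib, Finset.sum_const, Finset.card_univ, nsmul_eq_mul, ← Finset.mul_sum]
  ring

end Bookkeeping

section LapRow

variable (W : GaugeField (F.P K) 0 (Matrix.specialUnitaryGroup (Fin 2) ℂ))
  (Z : SiteL2K ℂ 3 (periodsT3 F K) c₀ W₂ →ₗ[ℂ] SiteL2K ℂ 3 (periodsT3 F K) c₀ W₂) (ζ : Site (F.P K) 0 → ℝ)

/-- The covariant difference of `λ := toL2S⁻¹φ` IS the member gradient read at the bond, up to `η`: `hs(D_μλ(y)) = η²·hs(toL2⁻¹(D_Wφ)⟨y,μ⟩)`,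
`η = eta F n K = ℓ⁻¹`. [cite: Balaban1985BackgroundPropagators, (3.3) p.391] -/
theorem hs_covD_eq_eta_sq_mul (φ : SiteL2K ℂ 3 (periodsT3 F K) c₀ W₂) (y : Site (F.P K) 0) (μ : Fin (F.P K).d) :
    ∑ j : Fin 2, ∑ k : Fin 2, ‖(covD (torusT (F.P K) 0) (fun μ z => bgUnits F K W ⟨z, μ⟩) μ ((toL2S F K c₀).symm φ) y) j k‖ ^ 2
      = (eta F n K) ^ 2 * ∑ j : Fin 2, ∑ k : Fin 2, ‖((toL2 F K c₀).symm (DL2 F n K c₀ W φ) ⟨y, μ⟩) j k‖ ^ 2 := by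
  have hη := eta_pos F n K
  have hφ : φ = toL2S F K c₀ ((toL2S F K c₀).symm φ) := (LinearEquiv.apply_symm_apply _ _).symm
  conv_rhs => rw [hφ, DL2_toL2S_eq_covDerivFwdT, covDerivFwdT_eq_smul_covD]
  rw [show (⟨y, μ⟩ : PBond (F.P K) 0).dir = μ from rfl, show (⟨y, μ⟩ : PBond (F.P K) 0).src = y from rfl, hs_smul, ← mul_assoc,
    ← mul_pow, mul_inv_cancel₀ hη.ne', one_pow, one_mul]

/-- ★★ **(h5-loc)**: with steps `|ζ(x±e_μ) − ζ(x)| ≤ a`, second differences `|ζ(x+e_μ) + ζ(x−e_μ) − 2ζ(x)| ≤ a₂`, `ζ` constant on the 2-cell about every site off `S`, and `S'` containing `S` and its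
one- and two-step translates, for EVERY `φ`:
`‖Δ_W(Z φ) − Z(Δ_W φ)‖² ≤ 18a²ℓ²·(c₀Σ_{y∈S'}Σ_μ‖toL2⁻¹(D_Wφ)⟨y,μ⟩‖_F²) + 27a₂²ℓ⁴·(c₀Σ_{x∈S}‖toL2S⁻¹φ x‖_F²)` — only the LOCAL gradient energy of `φ` NEAR THE TRANSITION SET
enters, so RECIPE v1 TRAP 1's boundary-layer jumps of a zero-extended chart potential never do (no `ζ̃` needed).
[cite: Balaban1985BackgroundPropagators, (3.23) p.394, (3.100) pp.413–414; Balaban1984PropagatorsII, p.238] -/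
theorem norm_sq_lapComm_le_local (hZ : ∀ φ x, (toL2S F K c₀).symm (Z φ) x = ζ x • (toL2S F K c₀).symm φ x) {a a₂ : ℝ} (S S' : Finset (Site (F.P K) 0))
    (hζ1 : ∀ (x : Site (F.P K) 0) (μ : Fin 3), |ζ (x.shift μ) - ζ x| ≤ a ∧ |ζ (x.unshift μ) - ζ x| ≤ a)
    (hζ2 : ∀ (x : Site (F.P K) 0) (μ : Fin 3), |ζ (x.shift μ) + ζ (x.unshift μ) - 2 * ζ x| ≤ a₂)
    (hζS : ∀ x : Site (F.P K) 0, x ∉ S → ∀ μ : Fin 3, ζ (x.shift μ) = ζ x ∧ ζ (x.unshift μ) = ζ x ∧ ∀ ν : Fin 3, ζ ((x.shift μ).shift ν) = ζ (x.shift μ))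
    (hSS' : ∀ x ∈ S, x ∈ S' ∧ ∀ μ : Fin 3, x.shift μ ∈ S' ∧ x.unshift μ ∈ S' ∧ ∀ ν : Fin 3, (x.shift μ).shift ν ∈ S')
    (φ : SiteL2K ℂ 3 (periodsT3 F K) c₀ W₂) :
    ‖covLapSite F n K c₀ W (Z φ) - Z (covLapSite F n K c₀ W φ)‖ ^ 2
      ≤ 18 * a ^ 2 * ((F.L : ℝ) ^ (K - n)) ^ 2 *
            (c₀ * ∑ y ∈ S', ∑ μ : Fin (F.P K).d, ∑ j : Fin 2, ∑ k : Fin 2, ‖((toL2 F K c₀).symm (DL2 F n K c₀ W φ) ⟨y, μ⟩) j k‖ ^ 2)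
        + 27 * a₂ ^ 2 * ((F.L : ℝ) ^ (K - n)) ^ 4 * (c₀ * ∑ x ∈ S, ∑ j : Fin 2, ∑ k : Fin 2, ‖((toL2S F K c₀).symm φ x) j k‖ ^ 2) := by
  classical
  have hc : (0 : ℝ) < c₀ := Fact.out
  have hη := eta_pos F n K
  have hηL : (eta F n K)⁻¹ = (F.L : ℝ) ^ (K - n) := by rw [T3SectALandauChart.eta, ← inv_pow, inv_inv]
  -- the function-letter row of the lineage, localised on `S`
  have h := norm_sq_covLapSite_comm_le F n K c₀ W ζ ((toL2S F K c₀).symm φ) S hζ1 hζ2 fun x hx μ => ⟨(hζS x hx μ).1, (hζS x hx μ).2.1⟩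
  rw [lapComm_eq_fun F n K c₀ Z ζ hZ W φ]
  refine h.trans ?_
  -- abbreviations
  set Y : PBond (F.P K) 0 → ℝ := fun b => ∑ j : Fin 2, ∑ k : Fin 2, ‖((toL2 F K c₀).symm (DL2 F n K c₀ W φ) b) j k‖ ^ 2 with hY
  set M : Site (F.P K) 0 → ℝ := fun x => ∑ j : Fin 2, ∑ k : Fin 2, ‖((toL2S F K c₀).symm φ x) j k‖ ^ 2 with hM
  have hY0 : ∀ b, 0 ≤ Y b := fun b => Finset.sum_nonneg fun _ _ => Finset.sum_nonneg fun _ _ => sq_nonneg _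
  have hM0 : ∀ x, 0 ≤ M x := fun x => Finset.sum_nonneg fun _ _ => Finset.sum_nonneg fun _ _ => sq_nonneg _
  -- the summand in the `Y`, `M` letters
  have hterm : ∀ (x : Site (F.P K) 0) (μ : Fin (F.P K).d),
      a ^ 2 * ∑ j : Fin 2, ∑ k : Fin 2, ‖(covD (torusT (F.P K) 0) (fun μ z => bgUnits F K W ⟨z, μ⟩) μ ((toL2S F K c₀).symm φ) (x.unshift μ)) j k‖ ^ 2
        + a ^ 2 * ∑ j : Fin 2, ∑ k : Fin 2, ‖(covD (torusT (F.P K) 0) (fun μ z => bgUnits F K W ⟨z, μ⟩) μ ((toL2S F K c₀).symm φ) x) j k‖ ^ 2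
        + a₂ ^ 2 * ∑ j : Fin 2, ∑ k : Fin 2, ‖((toL2S F K c₀).symm φ x) j k‖ ^ 2
      = (eta F n K) ^ 2 * a ^ 2 * Y ⟨x.unshift μ, μ⟩ + (eta F n K) ^ 2 * a ^ 2 * Y ⟨x, μ⟩ + a₂ ^ 2 * M x := by
    intro x μ
    rw [hs_covD_eq_eta_sq_mul F n K c₀ W φ (x.unshift μ) μ, hs_covD_eq_eta_sq_mul F n K c₀ W φ x μ]
    ring
  -- the two gradient sums sit inside `Σ_{y∈S'}Σ_μ Y⟨y,μ⟩`
  have hG1 : ∑ x ∈ S, ∑ μ : Fin (F.P K).d, Y ⟨x.unshift μ, μ⟩ ≤ ∑ y ∈ S', ∑ μ : Fin (F.P K).d, Y ⟨y, μ⟩ := by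
    rw [Finset.sum_comm]
    calc ∑ μ : Fin (F.P K).d, ∑ x ∈ S, Y ⟨x.unshift μ, μ⟩ ≤ ∑ μ : Fin (F.P K).d, ∑ y ∈ S', Y ⟨y, μ⟩ :=
          Finset.sum_le_sum fun μ _ => sum_comp_le_sum_of_mapsTo S S' (fun x => x.unshift μ) (unshift_injective (P := F.P K) (j := 0) μ)
            (fun x hx => ((hSS' x hx).2 μ).2.1) (fun y => Y ⟨y, μ⟩) fun y => hY0 _
      _ = _ := Finset.sum_comm
  have hG2 : ∑ x ∈ S, ∑ μ : Fin (F.P K).d, Y ⟨x, μ⟩ ≤ ∑ y ∈ S', ∑ μ : Fin (F.P K).d, Y ⟨y, μ⟩ :=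
    Finset.sum_le_sum_of_subset_of_nonneg (fun x hx => (hSS' x hx).1) fun y _ _ => Finset.sum_nonneg fun μ _ => hY0 _
  have hMsum : ∑ x ∈ S, ∑ _μ : Fin (F.P K).d, a₂ ^ 2 * M x = 3 * (a₂ ^ 2 * ∑ x ∈ S, M x) := by
    have hd : (Finset.univ : Finset (Fin (F.P K).d)).card = 3 := by rw [Finset.card_univ, Fintype.card_fin]; rfl
    simp only [Finset.sum_const, hd, nsmul_eq_mul, Nat.cast_ofNat, Finset.mul_sum]
  have hsum : ∑ x ∈ S, ∑ μ : Fin (F.P K).d,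
      (a ^ 2 * ∑ j : Fin 2, ∑ k : Fin 2, ‖(covD (torusT (F.P K) 0) (fun μ z => bgUnits F K W ⟨z, μ⟩) μ ((toL2S F K c₀).symm φ) (x.unshift μ)) j k‖ ^ 2
        + a ^ 2 * ∑ j : Fin 2, ∑ k : Fin 2, ‖(covD (torusT (F.P K) 0) (fun μ z => bgUnits F K W ⟨z, μ⟩) μ ((toL2S F K c₀).symm φ) x) j k‖ ^ 2
        + a₂ ^ 2 * ∑ j : Fin 2, ∑ k : Fin 2, ‖((toL2S F K c₀).symm φ x) j k‖ ^ 2)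
      ≤ (eta F n K) ^ 2 * a ^ 2 * (2 * ∑ y ∈ S', ∑ μ : Fin (F.P K).d, Y ⟨y, μ⟩) + 3 * (a₂ ^ 2 * ∑ x ∈ S, M x) := by
    rw [Finset.sum_congr rfl fun x _ => Finset.sum_congr rfl fun μ _ => hterm x μ]
    have hsplit : ∑ x ∈ S, ∑ μ : Fin (F.P K).d, ((eta F n K) ^ 2 * a ^ 2 * Y ⟨x.unshift μ, μ⟩ + (eta F n K) ^ 2 * a ^ 2 * Y ⟨x, μ⟩ + a₂ ^ 2 * M x)
        = (eta F n K) ^ 2 * a ^ 2 * ∑ x ∈ S, ∑ μ : Fin (F.P K).d, Y ⟨x.unshift μ, μ⟩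
          + (eta F n K) ^ 2 * a ^ 2 * ∑ x ∈ S, ∑ μ : Fin (F.P K).d, Y ⟨x, μ⟩ + ∑ x ∈ S, ∑ _μ : Fin (F.P K).d, a₂ ^ 2 * M x := by
      simp only [Finset.sum_add_distrib, ← Finset.mul_sum]
    rw [hsplit, hMsum]
    have hpos : 0 ≤ (eta F n K) ^ 2 * a ^ 2 := by positivity
    nlinarith [mul_le_mul_of_nonneg_left hG1 hpos, mul_le_mul_of_nonneg_left hG2 hpos]
  -- re-type the direction binder of the lineage's row (`Fin 3`) as `Fin (F.P K).d` (definitionally equal), then substitute `η⁻¹ = ℓ`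
  show 9 * (((eta F n K)⁻¹) ^ 2) ^ 2 * (c₀ * ∑ x ∈ S, ∑ μ : Fin (F.P K).d, _) ≤ _
  rw [hηL]
  have hηℓ : (eta F n K) * (F.L : ℝ) ^ (K - n) = 1 := by rw [← hηL, mul_inv_cancel₀ hη.ne']
  have hpre : 0 ≤ 9 * (((F.L : ℝ) ^ (K - n)) ^ 2) ^ 2 * c₀ := by positivity
  have key := mul_le_mul_of_nonneg_left hsum hpre
  refine (le_of_eq (by ring)).trans (key.trans (le_of_eq ?_))
  have e4 : (((F.L : ℝ) ^ (K - n)) ^ 2) ^ 2 * (eta F n K) ^ 2 = ((F.L : ℝ) ^ (K - n)) ^ 2 := by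
    calc (((F.L : ℝ) ^ (K - n)) ^ 2) ^ 2 * (eta F n K) ^ 2 = ((F.L : ℝ) ^ (K - n)) ^ 2 * ((eta F n K) * (F.L : ℝ) ^ (K - n)) ^ 2 := by ring
      _ = _ := by rw [hηℓ, one_pow, mul_one]
  linear_combination (18 * a ^ 2 * (c₀ * ∑ y ∈ S', ∑ μ : Fin (F.P K).d, Y ⟨y, μ⟩)) * e4

end LapRow

/-! ## §4 At the package's radii `a = (3∕2)(L^s·ℓ)⁻¹`, `a₂ = 6(L^s·ℓ)⁻²`: ABSOLUTE numerals and the budget's slot shape -/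

section Member

variable {e : ℝ} (W : GaugeField (F.P K) 0 (Matrix.specialUnitaryGroup (Fin 2) ℂ))
  (Z : SiteL2K ℂ 3 (periodsT3 F K) c₀ W₂ →ₗ[ℂ] SiteL2K ℂ 3 (periodsT3 F K) c₀ W₂)
  (ZE : BondL2K ℂ 3 (periodsT3 F K) c₀ W₂ →ₗ[ℂ] BondL2K ℂ 3 (periodsT3 F K) c₀ W₂) (ζ : Site (F.P K) 0 → ℝ) (s : ℕ)

/-- The radii letters: `R = L^s ≥ 1`, `ℓ = L^{K−n} ≥ 1`. [cite: Balaban1985Variational, (5) p.278] -/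
theorem one_le_pow_L (t : ℕ) : (1 : ℝ) ≤ (F.L : ℝ) ^ t := by
  have hL : (1 : ℝ) ≤ (F.L : ℝ) := by exact_mod_cast F.hL.2.le
  exact one_le_pow₀ hL

/-- ★★ **(h6) AT THE PACKAGE'S STEP `(3∕2)(L^s·ℓ)⁻¹`**: `‖D_W(Z φ) − ZE(D_W φ)‖² ≤ (27∕4)·(L^s)⁻²·(c₀Σ_{x∈S}‖toL2S⁻¹φ x‖_F²)` — the budget's `h6 : M ≤ CM·R⁻²·Φt` with
`CM = 27∕4` and `Φt =` the mass of `φ` on the transition set `S`. [cite: Balaban1985BackgroundPropagators, (3.3) p.391, (3.100) pp.413–414; Balaban1984PropagatorsII, p.238] -/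
theorem norm_sq_gradComm_le_member
    (hZ : ∀ φ x, (toL2S F K c₀).symm (Z φ) x = ζ x • (toL2S F K c₀).symm φ x) (hZE : ∀ f b, (toL2 F K c₀).symm (ZE f) b = ζ b.src • (toL2 F K c₀).symm f b)
    (S : Finset (Site (F.P K) 0))
    (hζ1 : ∀ (x : Site (F.P K) 0) (μ : Fin 3), |ζ (x.shift μ) - ζ x| ≤ 3 / 2 / ((F.L : ℝ) ^ s * (F.L : ℝ) ^ (K - n)) ∧
      |ζ (x.unshift μ) - ζ x| ≤ 3 / 2 / ((F.L : ℝ) ^ s * (F.L : ℝ) ^ (K - n)))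
    (hζS : ∀ x : Site (F.P K) 0, x ∉ S → ∀ μ : Fin 3, ζ (x.shift μ) = ζ x ∧ ζ (x.unshift μ) = ζ x ∧ ∀ ν : Fin 3, ζ ((x.shift μ).shift ν) = ζ (x.shift μ))
    (φ : SiteL2K ℂ 3 (periodsT3 F K) c₀ W₂) :
    ‖DL2 F n K c₀ W (Z φ) - ZE (DL2 F n K c₀ W φ)‖ ^ 2
      ≤ 27 / 4 * ((F.L : ℝ) ^ s)⁻¹ ^ 2 * (c₀ * ∑ x ∈ S, ∑ j : Fin 2, ∑ k : Fin 2, ‖((toL2S F K c₀).symm φ x) j k‖ ^ 2) := by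
  have h := norm_sq_gradComm_le_local F n K c₀ W Z ZE ζ hZ hZE S (fun x μ => (hζ1 x μ).1) hζS φ
  refine h.trans (le_of_eq ?_)
  have hR : (0 : ℝ) < (F.L : ℝ) ^ s := by linarith [one_le_pow_L F s]
  have hℓ : (0 : ℝ) < (F.L : ℝ) ^ (K - n) := by linarith [one_le_pow_L F (K - n)]
  field_simp
  ring

/-- ★★ **(h5) AT THE PACKAGE'S RADII** (`a = (3∕2)(L^s·ℓ)⁻¹`, `a₂ = 6(L^s·ℓ)⁻²`):
`‖Δ_W(Z φ) − Z(Δ_W φ)‖² ≤ (81∕2)·(L^s)⁻²·(c₀Σ_{y∈S'}Σ_μ‖toL2⁻¹(D_Wφ)⟨y,μ⟩‖_F²) + 972·(L^s)⁻⁴·(c₀Σ_{x∈S}‖toL2S⁻¹φ x‖_F²)`.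
[cite: Balaban1985BackgroundPropagators, (3.23) p.394, (3.100) pp.413–414; Balaban1984PropagatorsII, p.238] -/
theorem norm_sq_lapComm_le_member
    (hZ : ∀ φ x, (toL2S F K c₀).symm (Z φ) x = ζ x • (toL2S F K c₀).symm φ x) (S S' : Finset (Site (F.P K) 0))
    (hζ1 : ∀ (x : Site (F.P K) 0) (μ : Fin 3), |ζ (x.shift μ) - ζ x| ≤ 3 / 2 / ((F.L : ℝ) ^ s * (F.L : ℝ) ^ (K - n)) ∧
      |ζ (x.unshift μ) - ζ x| ≤ 3 / 2 / ((F.L : ℝ) ^ s * (F.L : ℝ) ^ (K - n)))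
    (hζ2 : ∀ (x : Site (F.P K) 0) (μ : Fin 3), |ζ (x.shift μ) + ζ (x.unshift μ) - 2 * ζ x| ≤ 6 / ((F.L : ℝ) ^ s * (F.L : ℝ) ^ (K - n)) ^ 2)
    (hζS : ∀ x : Site (F.P K) 0, x ∉ S → ∀ μ : Fin 3, ζ (x.shift μ) = ζ x ∧ ζ (x.unshift μ) = ζ x ∧ ∀ ν : Fin 3, ζ ((x.shift μ).shift ν) = ζ (x.shift μ))
    (hSS' : ∀ x ∈ S, x ∈ S' ∧ ∀ μ : Fin 3, x.shift μ ∈ S' ∧ x.unshift μ ∈ S' ∧ ∀ ν : Fin 3, (x.shift μ).shift ν ∈ S')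
    (φ : SiteL2K ℂ 3 (periodsT3 F K) c₀ W₂) :
    ‖covLapSite F n K c₀ W (Z φ) - Z (covLapSite F n K c₀ W φ)‖ ^ 2
      ≤ 81 / 2 * ((F.L : ℝ) ^ s)⁻¹ ^ 2 *
            (c₀ * ∑ y ∈ S', ∑ μ : Fin (F.P K).d, ∑ j : Fin 2, ∑ k : Fin 2, ‖((toL2 F K c₀).symm (DL2 F n K c₀ W φ) ⟨y, μ⟩) j k‖ ^ 2)
        + 972 * ((F.L : ℝ) ^ s)⁻¹ ^ 4 * (c₀ * ∑ x ∈ S, ∑ j : Fin 2, ∑ k : Fin 2, ‖((toL2S F K c₀).symm φ x) j k‖ ^ 2) := by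
  have h := norm_sq_lapComm_le_local F n K c₀ W Z ζ hZ S S' hζ1 hζ2 hζS hSS' φ
  refine h.trans (le_of_eq ?_)
  have hR : (0 : ℝ) < (F.L : ℝ) ^ s := by linarith [one_le_pow_L F s]
  have hℓ : (0 : ℝ) < (F.L : ℝ) ^ (K - n) := by linarith [one_le_pow_L F (K - n)]
  field_simp
  ring

/-- ★★ **(h5) IN THE BUDGET'S SLOT SHAPE** `L ≤ Cζ·(R⁻²·G + R⁻⁴·Φ)` with `Cζ = 972`, `R = L^s` (✓`Prop7DivRecoveryAssemblyBudgetW4.patch_budget_v2`, `h5`).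
[cite: Balaban1985BackgroundPropagators, (3.23) p.394, (3.100) pp.413–414] -/
theorem norm_sq_lapComm_le_slot
    (hZ : ∀ φ x, (toL2S F K c₀).symm (Z φ) x = ζ x • (toL2S F K c₀).symm φ x) (S S' : Finset (Site (F.P K) 0))
    (hζ1 : ∀ (x : Site (F.P K) 0) (μ : Fin 3), |ζ (x.shift μ) - ζ x| ≤ 3 / 2 / ((F.L : ℝ) ^ s * (F.L : ℝ) ^ (K - n)) ∧
      |ζ (x.unshift μ) - ζ x| ≤ 3 / 2 / ((F.L : ℝ) ^ s * (F.L : ℝ) ^ (K - n)))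
    (hζ2 : ∀ (x : Site (F.P K) 0) (μ : Fin 3), |ζ (x.shift μ) + ζ (x.unshift μ) - 2 * ζ x| ≤ 6 / ((F.L : ℝ) ^ s * (F.L : ℝ) ^ (K - n)) ^ 2)
    (hζS : ∀ x : Site (F.P K) 0, x ∉ S → ∀ μ : Fin 3, ζ (x.shift μ) = ζ x ∧ ζ (x.unshift μ) = ζ x ∧ ∀ ν : Fin 3, ζ ((x.shift μ).shift ν) = ζ (x.shift μ))
    (hSS' : ∀ x ∈ S, x ∈ S' ∧ ∀ μ : Fin 3, x.shift μ ∈ S' ∧ x.unshift μ ∈ S' ∧ ∀ ν : Fin 3, (x.shift μ).shift ν ∈ S')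
    (φ : SiteL2K ℂ 3 (periodsT3 F K) c₀ W₂) :
    ‖covLapSite F n K c₀ W (Z φ) - Z (covLapSite F n K c₀ W φ)‖ ^ 2
      ≤ 972 * (((F.L : ℝ) ^ s)⁻¹ ^ 2 *
            (c₀ * ∑ y ∈ S', ∑ μ : Fin (F.P K).d, ∑ j : Fin 2, ∑ k : Fin 2, ‖((toL2 F K c₀).symm (DL2 F n K c₀ W φ) ⟨y, μ⟩) j k‖ ^ 2)
          + ((F.L : ℝ) ^ s)⁻¹ ^ 4 * (c₀ * ∑ x ∈ S, ∑ j : Fin 2, ∑ k : Fin 2, ‖((toL2S F K c₀).symm φ x) j k‖ ^ 2)) := by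
  have h := norm_sq_lapComm_le_member F n K c₀ W Z ζ s hZ S S' hζ1 hζ2 hζS hSS' φ
  have hc : (0 : ℝ) < c₀ := Fact.out
  have hG : 0 ≤ ((F.L : ℝ) ^ s)⁻¹ ^ 2 *
      (c₀ * ∑ y ∈ S', ∑ μ : Fin (F.P K).d, ∑ j : Fin 2, ∑ k : Fin 2, ‖((toL2 F K c₀).symm (DL2 F n K c₀ W φ) ⟨y, μ⟩) j k‖ ^ 2) := by positivity
  nlinarith [hG]

end Member

end Summit.QuantumFields.YangMills.Theorems.Prop7Lane2PatchCommutatorRows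

end
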